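import Summits.BirchSwinnertonDyer.BirchSwinnertonDyer.Theorems.EisensteinPrimesResidualStrictEqUnramified
import Summits.BirchSwinnertonDyer.BirchSwinnertonDyer.Theorems.EisensteinPrimesRamifiedCharNoLocalFixed
import Summits.BirchSwinnertonDyer.BirchSwinnertonDyer.Theorems.EisensteinPrimesCharResidualSelmerCount
import HarnessLib

/-!
# `H¹_{𝓕_Gr^{S₀}} = H¹_{𝓕_nr^{S₀}}` over `K_∞` for `(F/𝒪)(ω̃)` and `𝔽(ω̃)`, and the STRICT residual count
# `#R_v̄^{S₀}(K_∞, 𝔽(ω̃)) = p^{λ(𝔛_ω̃^{S₀})} · #𝔛_ω̃^{S₀}[p]` — for a Teichmüller character RAMIFIED at `v̄`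
# (cell `bsd-eis`, seat `bsd-line-x1-p1-w4` gen 3, D-0154 WIDTH PASS; crux 2 `GoodLatticeBDPValue`
# stmt-BirchSwinnertonDyer-19032, line `halves` v19.1, V21 INDEX ROAD step (8) `ω̃` half `L_ω = 0`)

HONEST FRAMING (cell `bsd-eis`, run/shared/lean/pub/bsd-eis/): three-line corollaries of this seat's p642211
(`grSelmer_eq_unrSelmer_of_noFixed`), p643003 (`noFixed_kerSubgroup_inertia_of_hom`,
`charModule_noFixed_kerSubgroup_inertia`) and p642184 (`natCard_unrSelmer_residual_eq_pow_lambdaInvariant_mul`);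
no definition, no named fact, no `sorry`, no `Theses` import; nothing about any curve is asserted; BSD / IMC2 /
KY Thm. 1.4.1 are proved for NO curve. Helper `--supports stmt-BirchSwinnertonDyer-19032`.

The `E`-side dévissage of the cell (`ResidualDevissageCount*`, x2-p2) counts Castella-STRICT residual groups
`R_v̄^{S₀}(K_∞, ·) = grSelmer`; the character `λ`-invariants of the crux are duals of `unrSelmer`. For the
`ω̃`-type character (`θsub`, ramified at `v̄`: some `τ ∈ I_v̄` with `θ(τ) ≠ 1`) the two agree, at the residual
level and at the `p^∞` level, and the strict residual count is `p^{λ} · #𝔛[p]` (KY: «if `θ|_{G_v̄} = ω`, the two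
diagrams agree», arXiv:2402.12781v2 TeX L790–795; `λ_nr(ω̃) = λ_str(ω̃)` of the V21 memo step (8)). The
`𝟙̃`-type character (locally trivial at `v̄`, `L_1` of corank `s`) is NOT treated here.

References: [KellerYin2024] Lemma 1.2.4 and its proof, Lemma 1.4.3 (arXiv:2402.12781v2 TeX L736–800, L1186–1190);
[Greenberg1989] §1 p. 98.
-/

set_option autoImplicit false
set_option linter.dupNamespace false -- the summit namespace `…BirchSwinnertonDyer.BirchSwinnertonDyer.Theorems` (Sub = Summit, D-0017) trips it

noncomputable section

open scoped Classical

namespace Summit.BirchSwinnertonDyer.BirchSwinnertonDyer.Theorems.CharResidualSelmerCount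

open NumberField IsDedekindDomain Field
open Literature.NumberTheory.EllipticCurves Literature.NumberTheory.EllipticCurves.GreenbergSelmer
  Literature.NumberTheory.EllipticCurves.GreenbergVatsal2000 Literature.NumberTheory.GaloisRepresentations
  Literature.NumberTheory.EllipticCurves.KellerYin2024

variable {K : Type} [Field K] [NumberField K] {p : ℕ} [hp : Fact p.Prime] (κ : ZpExtension K p)
  {γ : absoluteGaloisGroup K} (vbar : HeightOneSpectrum (𝓞 K)) (S₀ : Set (HeightOneSpectrum (𝓞 K)))
  (θ : FramedGaloisRep K (padicCoeffIntegers (∅ : Set (PadicAlgCl p))) 1)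
  {A : Type} [AddCommGroup A] [DistribMulAction (absoluteGaloisGroup K) A] [TopologicalSpace A]
  [DiscreteTopology A]

/-- **`H¹_{𝓕_Gr^{S₀}}(K_∞, (F/𝒪)(θ)) = H¹_{𝓕_nr^{S₀}}(K_∞, (F/𝒪)(θ))` for `θ` RAMIFIED at `v̄`** (`θ^{p−1} = 1`,
some `τ ∈ I_v̄` with `θ(τ) ≠ 1`): `(F/𝒪)(θ)` has no non-zero `(ker κ ⊓ I_v̄)`-fixed vector
(`charModule_noFixed_kerSubgroup_inertia`), so `grSelmer_eq_unrSelmer_of_noFixed` applies. V21 step (8): `L_ω = 0`,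
`λ_nr(ω̃) = λ_str(ω̃)`. [cite: KellerYin2024, proof of Lemma 1.2.4 (arXiv:2402.12781v2 TeX L790–795)] -/
theorem grSelmer_charModule_eq_unrSelmer_of_ramified
    (hθ : ∀ σ : absoluteGaloisGroup K, θ σ ^ (p - 1) = 1)
    {τ : absoluteGaloisGroup K} (hτ : τ ∈ inertia vbar) (hne : unitChar θ τ ≠ 1) :
    grSelmer κ (charModule (∅ : Set (PadicAlgCl p)) θ) vbar S₀ =
      unrSelmer κ (charModule (∅ : Set (PadicAlgCl p)) θ) vbar S₀ :=
  grSelmer_eq_unrSelmer_of_noFixed κ vbar S₀ (charModule_noFixed_kerSubgroup_inertia κ θ hθ vbar hτ hne)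

/-- **`R_v̄^{S₀}(K_∞, A) = H¹_{𝓕_nr^{S₀}}(K_∞, A)` (strict = unramified residual group) for `A ↪ (F/𝒪)(θ)`
equivariant, `θ` ramified at `v̄`** (the residual line `𝔽(ω̃)`): no non-zero `(ker κ ⊓ I_v̄)`-fixed vector in `A`
(`noFixed_kerSubgroup_inertia_of_hom`). [cite: KellerYin2024, proof of Lemma 1.2.4 (arXiv:2402.12781v2 TeX L790–795)] -/
theorem grSelmer_eq_unrSelmer_of_hom_of_ramified
    (hθ : ∀ σ : absoluteGaloisGroup K, θ σ ^ (p - 1) = 1)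
    (j : A →+ charModule (∅ : Set (PadicAlgCl p)) θ)
    (hj : ∀ (σ : absoluteGaloisGroup K) (a : A), j (σ • a) = σ • j a) (hinj : Function.Injective j)
    {τ : absoluteGaloisGroup K} (hτ : τ ∈ inertia vbar) (hne : unitChar θ τ ≠ 1) :
    grSelmer κ A vbar S₀ = unrSelmer κ A vbar S₀ :=
  grSelmer_eq_unrSelmer_of_noFixed κ vbar S₀
    (noFixed_kerSubgroup_inertia_of_hom κ θ hθ j hj hinj vbar hτ hne)

/-- **The STRICT residual count for the `ω̃`-type character: `#R_v̄^{S₀}(K_∞, A) = p^{λ(𝔛_θ^{S₀})} · #𝔛_θ^{S₀}[p]`**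
for `A ↪ (F/𝒪)(θ)` onto the `p`-torsion, `θ^{p−1} = 1` ramified at `v̄`, and any dual datum `D` of
`H¹_{𝓕_nr^{S₀}}(K_∞, (F/𝒪)(θ))` finitely generated torsion with `μ = 0` — the `E`-side dévissage files' currency
(`datumStrictSelmer … bdpData = grSelmer`) joined to the crux's `λ`-currency (duals of `unrSelmer`).
[cite: KellerYin2024, Lemma 1.2.4, Lemma 1.4.3 (arXiv:2402.12781v2 TeX L760–800, L1186–1190)] -/
theorem natCard_grSelmer_residual_eq_pow_lambdaInvariant_mul_of_ramified
    (hθ : ∀ σ : absoluteGaloisGroup K, θ σ ^ (p - 1) = 1)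
    (j : A →+ charModule (∅ : Set (PadicAlgCl p)) θ)
    (hj : ∀ (σ : absoluteGaloisGroup K) (a : A), j (σ • a) = σ • j a) (hinj : Function.Injective j)
    (hrange : ∀ x : charModule (∅ : Set (PadicAlgCl p)) θ, x ∈ j.range ↔ p • x = 0)
    {τ : absoluteGaloisGroup K} (hτ : τ ∈ inertia vbar) (hne : unitChar θ τ ≠ 1)
    (D : DatumDualData κ γ (charModule (∅ : Set (PadicAlgCl p)) θ)
      (Castella2018.AcSelmer.bdpData (charModule (∅ : Set (PadicAlgCl p)) θ) p vbar) S₀)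
    [Module.Finite (IwasawaAlgebra p) D.X] (hT : Module.IsTorsion (IwasawaAlgebra p) D.X)
    (hμ : muInvariant p D.X = 0) :
    Nat.card (grSelmer κ A vbar S₀) = p ^ lambdaInvariant p D.X * Nat.card {x : D.X // p • x = 0} := by
  rw [grSelmer_eq_unrSelmer_of_hom_of_ramified κ vbar S₀ θ hθ j hj hinj hτ hne]
  exact natCard_unrSelmer_residual_eq_pow_lambdaInvariant_mul κ S₀ vbar θ hθ j hj hinj hrange D hT hμ

end Summit.BirchSwinnertonDyer.BirchSwinnertonDyer.Theorems.CharResidualSelmerCount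

end
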